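import Summits.QuantumFields.YangMills.Theorems.AlphaInputsT3ACv2RecData
import Summits.QuantumFields.YangMills.Theorems.UnitScaleTiltFluctuationComparisonRegPrSmallFieldEnvelope
import Summits.QuantumFields.YangMills.Theorems.UnitScaleTiltFluctuationComparisonRegPrSocketLevelsAlpha
import HarnessLib

/-!
# Route `UnitScaleTilt` — crux `FluctuationComparisonRegPrL` (stmt-QuantumFields-19935), STUB 3′ `stub_alphaTwoRunOfLane`, ADAPTER CONJUNCT
# `RepAtHeights` FOR THE CANONICAL v2 DATUM `AlphaInputsT3AC.OfV2At.dataT3c`, PART 1: the `Rm`-clauses and THE ONE-STEP LOWER ENVELOPE of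
# Bałaban's small-field recursion from the lane's (α) rows — support file `--supports stmt-QuantumFields-19935`

Fleet lead `ym-ust-19201-p1` (gen 4); owner ruling ym3-torus-plan g17-№1 §C (STUB 3′ concludes `∃ D, RepAtHeights D 𝔠.b₀ 𝔠.p₀ ε₀ ∧ PintDecomp D ∧
TwoRunMin D 𝔠.b₀ 𝔠.p₀ a`) and owner steer 2026-08-27T04:09:22Z («second pen on the adapter conjuncts»).

WHY `RepAtHeights` IS NOT AN INSTANTIATION OF THE DELIVERED (41)′/(47)′.  `RepAtHeights D b₀ p₀ ε₀ = T3LogComparisonSocket.TwoSidedRepAt F γ b₀ p₀ ε₀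
D.PintH D.EcstH D.RmH` speaks about the RESTRICTED height density `heightDensity F γ _ (histGood F ℰp (θBal F.L γ b₀ p₀) K n)` — run `K`'s Gibbs
density restricted to the UV-small history, read `n` levels below the unit lattice — whereas the (α) lane delivers `Ineq41AE`/`Ineq47AE`
(`AlphaInputsT3ACv2RecData`) for the UNRESTRICTED `resDensity F γ K univ j`.  Neither bound transfers by monotonicity (the restricted density is the
SMALLER one, so the full (47) does not bound it from below; the full (41) carries every large-field history).  On the window the restricted density IS
Bałaban's small-field recursion `τ_{j+1} = T_j(χ_j τ_j)` (this lineage's carrier `LogComparisonSmallFieldRecursion`, p450816), along which ONE-STEP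
envelopes propagate by positivity (`LogComparisonSmallFieldEnvelope`, p452326).  THIS FILE supplies the one-step LOWER envelope from the rows.

* §1 `dataT3c_rmH_clauses` — the two `Rm`-clauses of `TwoSidedRepAt` (`0 ≤ RmH`; summability along every free fraction `n = ⌊K/m⌋`) from the closed
  form `dataT3c_rmSize` through ★ym-ust-19201-p2's `LogComparisonSocketLevelsAlpha.rmH_clauses_of_rmSize`.
* §2 `expo47_succ_le_expo57_triv` — over ANY `B10.TowerRun` with step leaves `B10SectAGathering.StepLeaves T k`: the (47)_{k+1} exponent at the
  trivial history is below the (57)-exponent of the lower step leaf (LQB's `ineq47_succ_of_leaves` arithmetic without its `Bound55Lower` leaf).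
* §3 `lower47_oneStep_ae` (tower currency) and §4 `dataT3c_oneStep_lower` (route currency) — THE ONE-STEP LOWER ENVELOPE from the residual row
  `StepAlphaAC.fibre57Low` (R3D-02: `χ_{k+1}·exp[(57)] ≤ T_k[χ_k·exp((47)_k)]` `dV`-a.e.), the leaves `Thm2AC.stepLeavesOfAC` (all from the rows), the
  identification of the package's averaging with `blockAvg ℰp` (`avT3_of_le`) and the `dV`-a.e. homogeneity of the Radon–Nikodym transport
  (`rnTransport_const_mul_ae`): for `j + 1 ≤ K`, a.e. on the level-`(j+1)` fields, `ℓ_{j+1} ≤ T_j(𝟙_{window j}·ℓ_j)` with `ℓ_j := e^{−Ecst_j − Rm_j}·low_j`.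
Part 2 (`…RestrictedLower`) feeds this into the frame: (47) for the restricted height density and the lower half of `RepAtHeights`'s a.e. clause.
CONDITIONAL on the (α) rows (`OfV2At` is a hypothesis schema); nothing of [Balaban1985UV3] is asserted.

References: T. Bałaban, Commun. Math. Phys. 102 (1985) 255–275 [Balaban1985UV3] ((41) p.266, (47) p.267, (57) p.270, p.272 L32–33, Thm 2 p.272).
-/

set_option autoImplicit false

noncomputable section

namespace Summit.QuantumFields.YangMills.Theorems.RepAtHeightsAdapter

open MeasureTheory Filter
open Literature.MathematicalPhysics.QuantumFieldTheory.Balaban1983to89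
open Literature.MathematicalPhysics.QuantumFieldTheory.Balaban1983to89.B10 (TowerRun Ineq41 Ineq47)
open Literature.MathematicalPhysics.QuantumFieldTheory.Balaban1983to89.B10SectAGathering (StepPieces StepLeaves)
open Literature.MathematicalPhysics.QuantumFieldTheory.Balaban1983to89.AveragingRT (rnTransport)
open Literature.MathematicalPhysics.QuantumFieldTheory.Balaban1983to89.T3ContinuumYM3Torus
open Literature.MathematicalPhysics.QuantumFieldTheory.Balaban1983to89.T3UnitLawDensityEML (ℰp measurableE_ℰp measurable_blockAvg haarAC_blockAvg rt)
open Literature.MathematicalPhysics.QuantumFieldTheory.Balaban1983to89.T3UnitScaleTilt (θBal histGood measurableSet_plaqSmall)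
open Literature.MathematicalPhysics.QuantumFieldTheory.Balaban1983to89.T3LevelShift (fieldShift)
open Literature.MathematicalPhysics.QuantumFieldTheory.Balaban1983to89.T3RestrictedUnitDensity (towerDensity resDensity towerDensity_succ integrable_resDensity resDensity_nonneg)
open Literature.MathematicalPhysics.QuantumFieldTheory.Balaban1983to89.T3TiltDescent (heightDensity)
open Literature.MathematicalPhysics.QuantumFieldTheory.Balaban1983to89.T3AlphaInputsAC
open Literature.MathematicalPhysics.QuantumFieldTheory.Balaban1983to89.Missing (boltzmann)
open Literature.MathematicalPhysics.QuantumFieldTheory.Balaban1985CMP102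
open Literature.MathematicalPhysics.QuantumFieldTheory.Balaban1985CMP102.Setting
open Summit.QuantumFields.Balaban3D.Carriers
open Summit.QuantumFields.Balaban3D.Proofs.Primitives
open Summit.QuantumFields.Balaban3D.Proofs.TowerAC
open Summit.QuantumFields.Balaban3D.Proofs.StandardAC
open Summit.QuantumFields.Balaban3D.Proofs.InputsAC
open Summit.QuantumFields.Balaban3D.Proofs.AlphaAC
open Summit.QuantumFields.Balaban3D.Proofs.Bound55AC (hint47_stdAC)
open Summit.QuantumFields.Balaban3D.Proofs.Thm2AC
open Summit.QuantumFields.YangMills.Theorems.LogComparisonSmallFieldRecursion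
open Summit.QuantumFields.YangMills.Theorems.LogComparisonSmallFieldEnvelope

/-! ## §1 The `Rm`-clauses of `RepAtHeights` for the v2 datum -/

section RmClauses

variable {F : T3Family} {𝔠 : AlphaConsts F.L (suGroupModel 2).N} {a₀ a₁ : ℝ}
  (h : AlphaInputsT3AC.OfV2At F 𝔠 a₀ a₁) (hc : 0 < a₀ ∧ 0 < a₁ ∧ 𝔠.B₃ * a₁ ≤ a₀) (γ : ℝ) (hγ : 0 < γ)
  (hγ1 : γ ≤ (min 𝔠.gamma0 1) ^ 2) (π : AlphaInputsT3AC.PolymerT3 F)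

/-- **THE TWO `Rm`-CLAUSES OF `TwoSidedRepAt` FOR THE v2 DATUM**: `0 ≤ D.RmH K n` for all `K n`, and for every free top fraction `m ≥ 1`
`Σ_K (D.RmH K ⌊K/m⌋ + D.RmH (K+1) ⌊K/m⌋) < ∞` — the printed size of the remainder `Σ_{j<k} O((L^jε)^{3+κ₀})|T₁^{(j)}|` of (41)/(47) in the closed
form `dataT3c_rmSize` (`C = r⋆γ^{3+κ₀}`, `q = L^{−κ₀}`), summed by `LogComparisonSocketLevelsAlpha.rmH_clauses_of_rmSize`. [cite: Balaban1985UV3, (41) p.266] -/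
theorem dataT3c_rmH_clauses :
    (∀ K n : ℕ, 0 ≤ (h.dataT3c hc γ hγ hγ1 π).RmH K n) ∧
      ∀ m : ℕ, 0 < m → Summable fun K : ℕ => (h.dataT3c hc γ hγ hγ1 π).RmH K (K / m) + (h.dataT3c hc γ hγ hγ1 π).RmH (K + 1) (K / m) :=
  LogComparisonSocketLevelsAlpha.rmH_clauses_of_rmSize (h.dataT3c hc γ hγ hγ1 π) (h.dataT3c_rmSize hc γ hγ hγ1 π)

end RmClauses

/-! ## §2 The (47)_{k+1} exponent at the trivial history is below the (57) exponent of the lower step leaf (any `TowerRun`) -/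

section Exponents

variable {T : TowerRun} {k : ℕ}

/-- **THE EXPONENT BOOKKEEPING OF THE LOWER STEP AT THE TRIVIAL HISTORY** (the arithmetic of LQB's `ineq47_succ_of_leaves` without its
`Bound55Lower` leaf): given the step leaves at step `k` (`B10SectAGathering.StepLeaves T k`) and `k + 1 ≤ K`, for every level-`(k+1)` datum `U`,
`−mainT_{k+1}(triv,U) + Pint_{k+1}(triv,U) − E_{k+1} − Rm_{k+1} ≤ −mainT_{k+1}(triv,U) − E_k + (log σ₀ + d(𝔤) log g_k)|B(Λ_{k+1}(triv))*| +
log Z^{(k)}(B, U_{k+1}) + Pold(triv, U) − Rm_k + log Fl(triv, U)` — p.272 L32–33 «The lower bound is proved in the same way, with all simplifications coming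
from the fact that Ω_{k+1} = T_η»: at the trivial history `|Z_k| = 0`, so `CumulantLower`, `Repr33_60`, `VacuumWhole`, `Decomp35_61`, `Norm35`,
`StarCount` (`starB(triv) = starT`), `OldOutside`, `PintSucc`, `Estep62`, `Ecst_eq` (`E_{k+1} = E_k − E^{(k)}`) and `RmSucc` close the comparison.
[cite: Balaban1985UV3, (47) p.267 + (57)–(62) pp.270–271 + p.272 L32–33] -/
theorem expo47_succ_le_expo57_triv (S : StepLeaves T k) (hk : k + 1 ≤ T.K) (U : T.Cfg (k + 1)) :
    -(T.mainT (k + 1) (T.triv (k + 1)) U) + T.Pint (k + 1) (T.triv (k + 1)) U - T.Ecst (k + 1) - T.Rm (k + 1) ≤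
      -(T.mainT (k + 1) (T.triv (k + 1)) U) - T.Ecst k
        + (S.P.logσ₀ + S.P.dg * Real.log (T.g k)) * S.P.starB (T.triv (k + 1)) + S.P.logZU (T.triv (k + 1)) U
        + S.P.Pold (T.triv (k + 1)) U - T.Rm k + S.P.logFl (T.triv (k + 1)) U := by
  have hEcst : T.Ecst (k + 1) = T.Ecst k - T.Estep k := by
    rw [T.Ecst_eq, T.Ecst_eq, Finset.sum_eq_sum_Ico_succ_bot (by omega : k < T.K)]
    ring
  have hZ0 : S.P.Zvol (T.triv (k + 1)) = 0 := S.P.Zvol_triv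
  have h58' := S.cumulantLower U
  have h60' := abs_le.1 (S.repr33_60 (T.triv (k + 1)) U)
  have hvac' := abs_le.1 (S.vacuumWhole (T.triv (k + 1)))
  have h61' := abs_le.1 (S.decomp35_61 (T.triv (k + 1)) U)
  have h35' := abs_le.1 (S.norm35 (T.triv (k + 1)))
  have hold' := abs_le.1 (S.oldOutside (T.triv (k + 1)) U)
  obtain ⟨hs0, hs1⟩ := S.starCount (T.triv (k + 1))
  have hR : B10SectAGathering.RmSucc S.P (S.C₁' + S.C₂ + S.C₃ + S.C₄) :=
    S.rmSucc.mono (by have := le_max_right S.C₁ S.C₁'; linarith)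
  have hR' : T.Rm k + (S.C₁' + S.C₂ + S.C₃ + S.C₄) * S.P.rem ≤ T.Rm (k + 1) := hR
  rw [hZ0] at hvac' h35' hold' hs1
  rw [S.pintSucc (T.triv (k + 1)) U, hEcst, S.estep62]
  have hstarEq : S.P.starB (T.triv (k + 1)) = S.P.starT := by
    have : S.P.starT - S.P.starB (T.triv (k + 1)) ≤ 0 := by simpa using hs1
    linarith
  rw [hstarEq]
  nlinarith [h58', h60'.1, h60'.2, hvac'.1, hvac'.2, h61'.1, h61'.2, h35'.1, h35'.2, hold'.1, hold'.2, hR', S.P.rem_nonneg]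

end Exponents

/-! ## §3 The one-step lower envelope from the (α) residual row `fibre57Low`, in the route's currency -/

section OneStep

variable {F : T3Family} {𝔠 : AlphaConsts F.L (suGroupModel 2).N} {γ : ℝ} {hγ : 0 < γ} {hγ1 : γ ≤ (min 𝔠.gamma0 1) ^ 2} {K : ℕ}

/-- **THE LOWER STEP BOUND AT THE TRIVIAL HISTORY FOR THE PACKAGE'S TOWER, `dV`-a.e.** (tower currency): for `j + 1 ≤ K`, almost everywhere
on the level-`(j+1)` fields, the (47)_{j+1} minorant `χ_{j+1}·exp[−mainT_{j+1}(triv) + Pint_{j+1}(triv) − E_{j+1} − Rm_{j+1}]` is below ONE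
renormalisation transformation of the (47)_j minorant, `T_j[χ_j·exp((47)_j exponent)]` — the lane's (α) residual row `StepAlphaAC.fibre57Low`
(R3D-02, `Bound55AC.Fibre57LowAC`: «χ_{k+1}·exp[(57)] ≤ T_k[χ_k·exp((47)_k)]») composed with the exponent bookkeeping `expo47_succ_le_expo57_triv` over
the step leaves `Thm2AC.stepLeavesOfAC` (all discharged from the rows, C10 included).  This is the one-step lower envelope of print's induction for
(47), p.272 L32–33, for the `Ω_{k+1} = T_η` term ALONE — the form the restricted recursion consumes. [cite: Balaban1985UV3, (47) p.267 + (57) p.270 + p.272 L32–33] -/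
theorem lower47_oneStep_ae (p : AlphaInputsT3AC.PkgAt F 𝔠 γ hγ hγ1 K) (j : ℕ) (hj : j + 1 ≤ K) :
    (fun V => p.T.χ (j + 1) V * Real.exp (-(p.T.mainT (j + 1) (p.T.triv (j + 1)) V) + p.T.Pint (j + 1) (p.T.triv (j + 1)) V
        - p.T.Ecst (j + 1) - p.T.Rm (j + 1)))
      ≤ᵐ[fieldMeasure (F.P K) (j + 1) (Matrix.specialUnitaryGroup (Fin 2) ℂ)]
    rnTransport (p.X.av j).avg (fun U => p.T.χ j U * Real.exp (-(p.T.mainT j (p.T.triv j) U) + p.T.Pint j (p.T.triv j) U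
        - p.T.Ecst j - p.T.Rm j)) := by
  have hlow := (p.run.steps j hj).fibre57Low
  filter_upwards [hlow] with V hV
  refine le_trans ?_ hV
  exact mul_le_mul_of_nonneg_left (Real.exp_le_exp.mpr (expo47_succ_le_expo57_triv
    (stepLeavesOfAC j hj (stepResidualsAC_of_alpha (T3Scales_window F 𝔠 γ hγ hγ1 K) j hj (p.run.steps j hj))) hj V))
    (p.T.χ_nonneg (j + 1) V)

/-- Exponential bookkeeping: `e^{−(Ec−E)−Rm}·(χ·e^{a}) = e^{E}·(χ·e^{a−Ec−Rm})`. [folklore] -/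
theorem exp_shuffle (χ a Ec Rm E : ℝ) :
    Real.exp (-(Ec - E) - Rm) * (χ * Real.exp a) = Real.exp E * (χ * Real.exp (a - Ec - Rm)) := by
  rw [show -(Ec - E) - Rm = E + (-Ec - Rm) by ring, Real.exp_add, show a - Ec - Rm = a + (-Ec - Rm) by ring, Real.exp_add]
  ring

end OneStep

/-! ## §4 The one-step lower envelope in the route's currency (the v2 datum `dataT3c`) -/

section Restricted

variable {F : T3Family} {𝔠 : AlphaConsts F.L (suGroupModel 2).N} {a₀ a₁ : ℝ}
  (h : AlphaInputsT3AC.OfV2At F 𝔠 a₀ a₁) (hc : 0 < a₀ ∧ 0 < a₁ ∧ 𝔠.B₃ * a₁ ≤ a₀) (γ : ℝ) (hγ : 0 < γ)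
  (hγ1 : γ ≤ (min 𝔠.gamma0 1) ^ 2) (π : AlphaInputsT3AC.PolymerT3 F)

/-- **THE INTERFACE'S (47)-MINORANT WITH ITS CONSTANTS IS `e^{E}` TIMES THE TOWER'S (47) MINORANT** (route normalisation `Ecst K j = E_j − E`):
`e^{−Ecst_j − Rm_j}·low_j(W) = e^{E}·χ_j(W)·exp[−mainT_j(triv,W) + Pint_j(triv,W) − E_j − Rm_j]`. [cite: Balaban1985UV3, (47) p.267] -/
theorem dataT3c_ell_eq (K j : ℕ) (W : GaugeField (F.P K) j (Matrix.specialUnitaryGroup (Fin 2) ℂ)) :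
    Real.exp (-((h.dataT3c hc γ hγ hγ1 π).Ecst K j) - (h.dataT3c hc γ hγ hγ1 π).Rm K j) * (h.dataT3c hc γ hγ hγ1 π).low K j W =
      Real.exp (h.pkgAtV2 hc γ hγ hγ1 K).E *
        ((h.pkgAtV2 hc γ hγ hγ1 K).T.χ j W *
          Real.exp (-((h.pkgAtV2 hc γ hγ hγ1 K).T.mainT j ((h.pkgAtV2 hc γ hγ hγ1 K).T.triv j) W)
            + (h.pkgAtV2 hc γ hγ hγ1 K).T.Pint j ((h.pkgAtV2 hc γ hγ hγ1 K).T.triv j) W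
            - (h.pkgAtV2 hc γ hγ hγ1 K).T.Ecst j - (h.pkgAtV2 hc γ hγ hγ1 K).T.Rm j)) :=
  exp_shuffle _ _ _ _ _

/-- **OFF THE WINDOW THE MINORANT VANISHES, ON IT NOTHING CHANGES**: the level-`j` window's indicator times `e^{−Ecst−Rm}·low_j` IS
`e^{−Ecst−Rm}·low_j` (`χ_j` is the window's indicator, `dataT3c_chi_eq`), written as `e^{E}` times the tower's minorant. [cite: Balaban1985UV3, (47) p.267] -/
theorem dataT3c_indicator_ell_eq (K j : ℕ) (hj : j ≤ K) :
    {W' : GaugeField (F.P K) j (Matrix.specialUnitaryGroup (Fin 2) ℂ) | PlaqSmall (θBal F.L γ 𝔠.b₀ 𝔠.p₀ (K - j)) W'}.indicator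
        (fun W' => Real.exp (-((h.dataT3c hc γ hγ hγ1 π).Ecst K j) - (h.dataT3c hc γ hγ hγ1 π).Rm K j) *
          (h.dataT3c hc γ hγ hγ1 π).low K j W') =
      fun W' => Real.exp (h.pkgAtV2 hc γ hγ hγ1 K).E *
        ((h.pkgAtV2 hc γ hγ hγ1 K).T.χ j W' *
          Real.exp (-((h.pkgAtV2 hc γ hγ hγ1 K).T.mainT j ((h.pkgAtV2 hc γ hγ hγ1 K).T.triv j) W')
            + (h.pkgAtV2 hc γ hγ hγ1 K).T.Pint j ((h.pkgAtV2 hc γ hγ hγ1 K).T.triv j) W'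
            - (h.pkgAtV2 hc γ hγ hγ1 K).T.Ecst j - (h.pkgAtV2 hc γ hγ hγ1 K).T.Rm j)) := by
  funext W'
  by_cases hs : PlaqSmall (θBal F.L γ 𝔠.b₀ 𝔠.p₀ (K - j)) W'
  · rw [Set.indicator_of_mem (show W' ∈ {W' | PlaqSmall (θBal F.L γ 𝔠.b₀ 𝔠.p₀ (K - j)) W'} from hs)]
    exact dataT3c_ell_eq h hc γ hγ hγ1 π K j W'
  · rw [Set.indicator_of_notMem (show W' ∉ {W' | PlaqSmall (θBal F.L γ 𝔠.b₀ 𝔠.p₀ (K - j)) W'} from hs)]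
    have hχ : (h.pkgAtV2 hc γ hγ hγ1 K).T.χ j W' = 0 := by
      have e := h.dataT3c_chi_eq hc γ hγ hγ1 π K j hj W'
      rw [show (h.dataT3c hc γ hγ hγ1 π).χ K j W' = (h.pkgAtV2 hc γ hγ hγ1 K).T.χ j W' from rfl] at e
      rw [e]
      unfold chiSmall
      rw [if_neg]
      exact fun hon => hs fun q => hon q (Set.mem_univ q)
    rw [hχ, zero_mul, mul_zero]

/-- **THE ONE-STEP LOWER ENVELOPE IN THE ROUTE'S CURRENCY** (the `hstep` input of `LogComparisonSmallFieldEnvelope.sandwich_of_oneStep`, lower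
half): for `j + 1 ≤ K`, almost everywhere on the level-`(j+1)` fields of run `K`, `ℓ_{j+1} ≤ T_j(𝟙_{window j}·ℓ_j)` with
`ℓ_j := e^{−Ecst_j − Rm_j}·low_j` — `lower47_oneStep_ae` (row `fibre57Low` + leaves), the averaging of the package being the family's
`blockAvg ℰp` (`avT3_of_le`), and the `dV`-a.e. homogeneity of the Radon–Nikodym transport under the constant `e^{E}`
(`rnTransport_const_mul_ae`, integrability of the (47)_j minorant from the rows, `Bound55AC.hint47_stdAC`). [cite: Balaban1985UV3, (47) p.267 + p.272 L32–33] -/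
theorem dataT3c_oneStep_lower (K j : ℕ) (hj : j + 1 ≤ K) :
    ∀ᵐ W ∂fieldMeasure (F.P K) (j + 1) (Matrix.specialUnitaryGroup (Fin 2) ℂ),
      Real.exp (-((h.dataT3c hc γ hγ hγ1 π).Ecst K (j + 1)) - (h.dataT3c hc γ hγ hγ1 π).Rm K (j + 1)) *
          (h.dataT3c hc γ hγ hγ1 π).low K (j + 1) W ≤
        (rt F K j (by omega)).T
          ({W' : GaugeField (F.P K) j (Matrix.specialUnitaryGroup (Fin 2) ℂ) | PlaqSmall (θBal F.L γ 𝔠.b₀ 𝔠.p₀ (K - j)) W'}.indicator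
            (fun W' => Real.exp (-((h.dataT3c hc γ hγ hγ1 π).Ecst K j) - (h.dataT3c hc γ hγ hγ1 π).Rm K j) *
              (h.dataT3c hc γ hγ hγ1 π).low K j W')) W := by
  have hj' : j + 1 ≤ F.m + K := by omega
  -- the tower-currency one-step bound, with the package's averaging identified as `blockAvg ℰp`
  have hA := lower47_oneStep_ae (h.pkgAtV2 hc γ hγ hγ1 K).toPkgAt j hj
  have hav : (h.pkgAtV2 hc γ hγ hγ1 K).toPkgAt.X.av j = BlockAveraging.blockAvg (P := F.P K) (j := j) ℰp := by
    show avT3 F K j = _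
    exact avT3_of_le F K hj'
  rw [hav] at hA
  -- integrability and non-negativity of the (47)_j minorant (rows `hU`, `hPm`, `hPb`)
  have A := (h.pkgAtV2 hc γ hγ hγ1 K).run.steps j hj
  have hint := hint47_stdAC (h.pkgAtV2 hc γ hγ hγ1 K).toPkgAt.X 𝔠.lane.carrier (h.pkgAtV2 hc γ hγ hγ1 K).𝔖 (fun _ => True) j
    (A.hU _) (A.hPm _) ((h.pkgAtV2 hc γ hγ hγ1 K).𝔄.cP j) (A.hPb _)
  have h0 : ∀ U : GaugeField (F.P K) j (Matrix.specialUnitaryGroup (Fin 2) ℂ),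
      0 ≤ (h.pkgAtV2 hc γ hγ hγ1 K).T.χ j U *
          Real.exp (-((h.pkgAtV2 hc γ hγ hγ1 K).T.mainT j ((h.pkgAtV2 hc γ hγ hγ1 K).T.triv j) U)
            + (h.pkgAtV2 hc γ hγ hγ1 K).T.Pint j ((h.pkgAtV2 hc γ hγ hγ1 K).T.triv j) U
            - (h.pkgAtV2 hc γ hγ hγ1 K).T.Ecst j - (h.pkgAtV2 hc γ hγ hγ1 K).T.Rm j) :=
    fun U => mul_nonneg ((h.pkgAtV2 hc γ hγ hγ1 K).T.χ_nonneg j U) (Real.exp_nonneg _)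
  have hhom : rnTransport (BlockAveraging.blockAvg (P := F.P K) (j := j) ℰp).avg
      (fun U => Real.exp (h.pkgAtV2 hc γ hγ hγ1 K).E *
        ((h.pkgAtV2 hc γ hγ hγ1 K).T.χ j U *
          Real.exp (-((h.pkgAtV2 hc γ hγ hγ1 K).T.mainT j ((h.pkgAtV2 hc γ hγ hγ1 K).T.triv j) U)
            + (h.pkgAtV2 hc γ hγ hγ1 K).T.Pint j ((h.pkgAtV2 hc γ hγ hγ1 K).T.triv j) U
            - (h.pkgAtV2 hc γ hγ hγ1 K).T.Ecst j - (h.pkgAtV2 hc γ hγ hγ1 K).T.Rm j)))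
      =ᵐ[fieldMeasure (F.P K) (j + 1) (Matrix.specialUnitaryGroup (Fin 2) ℂ)]
    fun V => Real.exp (h.pkgAtV2 hc γ hγ hγ1 K).E * rnTransport (BlockAveraging.blockAvg (P := F.P K) (j := j) ℰp).avg
      (fun U => (h.pkgAtV2 hc γ hγ hγ1 K).T.χ j U *
          Real.exp (-((h.pkgAtV2 hc γ hγ hγ1 K).T.mainT j ((h.pkgAtV2 hc γ hγ hγ1 K).T.triv j) U)
            + (h.pkgAtV2 hc γ hγ hγ1 K).T.Pint j ((h.pkgAtV2 hc γ hγ hγ1 K).T.triv j) U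
            - (h.pkgAtV2 hc γ hγ hγ1 K).T.Ecst j - (h.pkgAtV2 hc γ hγ hγ1 K).T.Rm j)) V :=
    rnTransport_const_mul_ae (BlockAveraging.blockAvg (P := F.P K) (j := j) ℰp).avg _ h0 hint
      (Real.exp_nonneg (h.pkgAtV2 hc γ hγ hγ1 K).E)
  rw [dataT3c_indicator_ell_eq h hc γ hγ hγ1 π K j (by omega)]
  filter_upwards [hA, hhom] with W hAW hhomW
  show _ ≤ rnTransport (BlockAveraging.blockAvg (P := F.P K) (j := j) ℰp).avg _ W
  rw [dataT3c_ell_eq h hc γ hγ hγ1 π K (j + 1) W]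
  refine (mul_le_mul_of_nonneg_left hAW (Real.exp_nonneg _)).trans (le_of_eq ?_)
  exact hhomW.symm

end Restricted

end Summit.QuantumFields.YangMills.Theorems.RepAtHeightsAdapter

end
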